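import Summits.BirchSwinnertonDyer.BirchSwinnertonDyer.Theorems.GenusKolyvaginAtTwoMinimalTwinBSDTwoOrdinaryTwist
import Summits.BirchSwinnertonDyer.Rank1Residual.F1Sign2.AnalyticLineTransferAtTwo
import Literature.NumberTheory.EllipticCurves.RationalIsogenyFrobeniusCriterion
import Literature.NumberTheory.EllipticCurves.SzpiroLocalDataProofs
import Literature.NumberTheory.EllipticCurves.TwoAdicImageQuadraticTwistProofs
import Literature.NumberTheory.EllipticCurves.OrdinaryPrimesProofs
import Literature.NumberTheory.EllipticCurves.Greenberg1999.TwoTorsionRamifiedAtTwoValuationProofs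
import HarnessLib

/-!
# Route `AlignedTransportAtTwo`, crux C2 `MainConjectureOfRankZeroBSDAtTwo` (stmt-BirchSwinnertonDyer-22298):
# THE ORDINARY STANDARD SHAPE — every globally minimal curve good ORDINARY at `2` is `ℤ`-isomorphic (`u = 1`) to an
# integer STANDARD MODEL `[1, a₂, 0, a₄, a₆]` with `a₄ + a₆` odd; its `u`-cubic is a translate of the SHAPE CUBIC
# `u³ + (1 + 4a₂)u² + 16a₄u + 64a₆`; and C2 BY NAME from the named input in INTEGER-TRIPLE currency

HONEST FRAMING. WIDTH-5 attached prover seat `bsd-line-att-p4` g35 on line `birth` of the lead `bsd-line-att-p2` (WAKE-only); `--supports`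
stmt-BirchSwinnertonDyer-22298, closes nothing; BSD is NOT proved; crux C2, its verdict «blocked-on `Rank1Residual.GreenbergMuConjectureIrreducible`»
and every registered stub (P / T / Kμ / LimDoor / MuIneqʳ / PFμ⁺ of `Lines/birth.lean` v9) untouched. THEOREMS ONLY (no `def`, no named fact, no `sorry`).
Sequel of this seat's `…NarrowCubicNamedInput{,Dyadic}` / `…CubicDiscriminantSquareClass{,Polynomial}` (att-p4 g33/g34: C2 BY NAME from «narrow
`μ₂⁺ = 0` for every non-cyclic cubic field», then for the dyadic ones, then for the dyadic ones with `v₂(d_F)` even). Those binder classes are FIELD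
classes containing the cubic `2`-torsion fields of the cell; whether they are EXACTLY that image was left open («decorative», g34). In the currency of
this file — integer triples `(a₂, a₄, a₆)` — exactness is free (the converse construction is the standard model itself, `…OrdinaryStandardShapeExact`).

* §1 THE STANDARD FAMILY `M(a₂,a₄,a₆) = [1, a₂, 0, a₄, a₆]` over `ℤ`: `Δ ≡ a₄ + a₆ (mod 2)` (`odd_Δ_standard_iff`), `c₄` odd, `b₂ = 1 + 4a₂`, `b₄ = 2a₄`,
  `b₆ = 4a₆`; the `u`-cubic of `M ⊗ ℚ` IS the shape cubic `u³ + (1 + 4a₂)u² + 16a₄u + 64a₆` (`twoDivisionUCubic_standard`); `disc = 256·Δ`; `M ⊗ ℚ` is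
  elliptic when `a₄ + a₆` is odd; `E(ℚ)[2] = 0` ⟺ the shape cubic has no rational root; once globally minimal, `M ⊗ ℚ` is good ORDINARY at `2`.
* §2 ★★ THE NORMAL FORM OVER `ℤ` (`exists_variableChange_a₁_one_a₃_zero`, W-free): an integer model with `a₁` ODD is carried by the INTEGRAL change of
  variables `(1; a₃, −k, −a₃(k+1))` (`a₁ = 2k + 1`) to one with `a₁ = 1`, `a₃ = 0` — no unit `u = a₁` is needed (the DVR normal form
  `exists_smul_ordinaryNormalForm` of `QuadraticTwistGoodReductionCharTwoProofs` rescales by `a₁`, impossible over `ℤ`). ★★ `exists_standardShape_of_isOrdinaryAt`: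
  for `W` globally minimal and good ordinary at `2` there are integers `a₂, a₄, a₆, r` with `a₄ + a₆` odd, `Δ[1,a₂,0,a₄,a₆] = Δ_min(W)`, and
  `c_W(e) = 0 ⟺ g(e − 4r) = 0` in every field of characteristic `0` (`g` the shape cubic): THE `u`-CUBIC OF A CELL CURVE IS A TRANSLATE OF A SHAPE CUBIC.
* §3 (sequel `…OrdinaryStandardShapeCrux`, route-dependent): C2 BY NAME from «narrow `μ₂⁺ = 0` for every non-Galois cubic field containing a
  root of a shape cubic without rational root» + PRINT⁵ + MuIneqʳ, and the registered stub PFμ⁺ from the same input. THIS file is ROUTE-INDEPENDENT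
  (no `Theses` import): elementary algebra of Weierstrass models over `ℤ` and `ℚ`.
RESTATEMENT MENU (D-0014): `NarrowMuTwoOfOrdinaryStandardShape : Prop` = the §3 binder verbatim [conjecture; instance of Iwasawa's `μ = 0` conjecture /
Greenberg–Kida narrow form; OPEN IN PRINT]; by `…OrdinaryStandardShapeExact` it is EQUIVALENT to «narrow `μ₂⁺ = 0` for the cubic `2`-torsion field of
every globally minimal `W` good ordinary at `2` with `W(ℚ)[2] = 0`, `Δ_W ∉ ℚ²`», i.e. to C2's PFμ⁺-type input stripped of `r_an`/`BSD₂`/CM/`μ_an`.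
Expected REF2 grade: TEXTBOOK (Silverman III.1 Table 3.1) + COROLLARY-OF-TREE. PARTITION: none; beyond-print theorem: no; BSD is NOT proved by any of this.

References: [SilvermanAEC2009] III.§1 Table 3.1, VII.§1, VIII.§8; [Kida1982JFields] Thm. 1, Remark (ii); [Greenberg2001IwasawaPastPresent] §4;
[Kato2004Asterisque] Thm. 17.4; [GreenbergLNM1716] Thm. 4.1; tree: `…NarrowCubicNamedInput` (g33), `…FineRoadRealKummerLinesLetterSwitch*` (att-p5 g15),
`F1Sign2.twoDivisionUCubic`, `OrdinaryTwistAtTwo.isOrdinaryAt_two_iff_odd_a₁`.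
-/

-- the Theorems namespace of this sub repeats the summit name by design (D-0017 nested layout)
set_option linter.dupNamespace false
set_option autoImplicit false

noncomputable section

open scoped NumberField

namespace Summit.BirchSwinnertonDyer.BirchSwinnertonDyer.Theorems.AlignedTransportAtTwoOrdinaryStandardShape

open NumberField Polynomial WeierstrassCurve
  Literature.NumberTheory.EllipticCurves Literature.NumberTheory.EllipticCurves.Greenberg1999
  Summit.BirchSwinnertonDyer.Rank1Residual.F1Sign2

/-! ## §0 The `u`-cubic evaluated -/

section Eval

/-- `c_W(e) = e³ + b₂e² + 8b₄e + 16b₆` in any field of characteristic `0`. [cite: SilvermanAEC2009, III.§1] -/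
theorem aeval_twoDivisionUCubic_eq (W : WeierstrassCurve ℚ) {K : Type*} [Field K] [CharZero K] [Algebra ℚ K] (e : K) :
    aeval e (twoDivisionUCubic W) = e ^ 3 + (W.b₂ : K) * e ^ 2 + 8 * (W.b₄ : K) * e + 16 * (W.b₆ : K) := by
  simp only [twoDivisionUCubic, map_add, map_mul, map_pow, aeval_X, aeval_C, eq_ratCast]
  push_cast
  ring

end Eval

/-! ## §1 The standard family `[1, a₂, 0, a₄, a₆]` over `ℤ` -/

section Standard

variable (a₂ a₄ a₆ : ℤ)

/-- `Δ[1, a₂, 0, a₄, a₆] = a₄² − a₆ + 2·(…)` — the discriminant of a standard model, split into its parity part. [cite: SilvermanAEC2009, III.§1] -/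
theorem Δ_standard_eq :
    (⟨1, a₂, 0, a₄, a₆⟩ : WeierstrassCurve ℤ).Δ =
      a₄ ^ 2 - a₆ + 2 * (4 * a₂ * a₄ ^ 2 + 8 * a₂ ^ 2 * a₄ ^ 2 - 6 * a₂ * a₆ - 24 * a₂ ^ 2 * a₆ - 32 * a₂ ^ 3 * a₆
        - 32 * a₄ ^ 3 - 216 * a₆ ^ 2 + 36 * a₄ * a₆ + 144 * a₂ * a₄ * a₆) := by
  simp only [WeierstrassCurve.Δ, WeierstrassCurve.b₂, WeierstrassCurve.b₄, WeierstrassCurve.b₆, WeierstrassCurve.b₈]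
  ring

/-- ★ **`Δ[1, a₂, 0, a₄, a₆]` is odd iff `a₄ + a₆` is odd** (`Δ ≡ a₄² − a₆ ≡ a₄ + a₆ (mod 2)`): the standard model has good reduction at `2` exactly when
`a₄ + a₆` is odd. [cite: SilvermanAEC2009, III.§1 and VII.§1 Remark 1.1] -/
theorem odd_Δ_standard_iff : Odd (⟨1, a₂, 0, a₄, a₆⟩ : WeierstrassCurve ℤ).Δ ↔ Odd (a₄ + a₆) := by
  have hE : Even (2 * (4 * a₂ * a₄ ^ 2 + 8 * a₂ ^ 2 * a₄ ^ 2 - 6 * a₂ * a₆ - 24 * a₂ ^ 2 * a₆ - 32 * a₂ ^ 3 * a₆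
        - 32 * a₄ ^ 3 - 216 * a₆ ^ 2 + 36 * a₄ * a₆ + 144 * a₂ * a₄ * a₆)) := even_two_mul _
  rw [Δ_standard_eq, Int.odd_add, Int.odd_sub, Int.odd_pow' two_ne_zero, Int.odd_add]
  exact ⟨fun h ↦ h.mpr hE, fun h ↦ iff_of_true h hE⟩

/-- `c₄[1, a₂, 0, a₄, a₆] = (1 + 4a₂)² − 48a₄` is odd. [cite: SilvermanAEC2009, III.§1] -/
theorem odd_c₄_standard : Odd (⟨1, a₂, 0, a₄, a₆⟩ : WeierstrassCurve ℤ).c₄ := by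
  refine ⟨4 * a₂ + 8 * a₂ ^ 2 - 24 * a₄, ?_⟩
  simp only [WeierstrassCurve.c₄, WeierstrassCurve.b₂, WeierstrassCurve.b₄]
  ring

/-- `b₂(M ⊗ ℚ) = 1 + 4a₂`. [cite: SilvermanAEC2009, III.§1] -/
theorem b₂_standard : ((⟨1, a₂, 0, a₄, a₆⟩ : WeierstrassCurve ℤ).baseChange ℚ).b₂ = 1 + 4 * (a₂ : ℚ) := by
  simp only [WeierstrassCurve.baseChange, WeierstrassCurve.map, WeierstrassCurve.b₂, algebraMap_int_eq, Int.coe_castRingHom]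
  push_cast
  ring

/-- `b₄(M ⊗ ℚ) = 2a₄`. [cite: SilvermanAEC2009, III.§1] -/
theorem b₄_standard : ((⟨1, a₂, 0, a₄, a₆⟩ : WeierstrassCurve ℤ).baseChange ℚ).b₄ = 2 * (a₄ : ℚ) := by
  simp only [WeierstrassCurve.baseChange, WeierstrassCurve.map, WeierstrassCurve.b₄, algebraMap_int_eq, Int.coe_castRingHom]
  push_cast
  ring

/-- `b₆(M ⊗ ℚ) = 4a₆`. [cite: SilvermanAEC2009, III.§1] -/
theorem b₆_standard : ((⟨1, a₂, 0, a₄, a₆⟩ : WeierstrassCurve ℤ).baseChange ℚ).b₆ = 4 * (a₆ : ℚ) := by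
  simp only [WeierstrassCurve.baseChange, WeierstrassCurve.map, WeierstrassCurve.b₆, algebraMap_int_eq, Int.coe_castRingHom]
  push_cast
  ring

/-- ★ **THE `u`-CUBIC OF THE STANDARD MODEL IS THE SHAPE CUBIC**: `twoDivisionUCubic ([1, a₂, 0, a₄, a₆] ⊗ ℚ) = X³ + (1 + 4a₂)X² + 16a₄X + 64a₆`.
[cite: SilvermanAEC2009, III.§1 (2-division polynomial, b₂, b₄, b₆)] -/
theorem twoDivisionUCubic_standard :
    twoDivisionUCubic ((⟨1, a₂, 0, a₄, a₆⟩ : WeierstrassCurve ℤ).baseChange ℚ) =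
      X ^ 3 + C (1 + 4 * (a₂ : ℚ)) * X ^ 2 + C (16 * (a₄ : ℚ)) * X + C (64 * (a₆ : ℚ)) := by
  have h4 : (8 : ℚ) * (2 * (a₄ : ℚ)) = 16 * (a₄ : ℚ) := by ring
  have h6 : (16 : ℚ) * (4 * (a₆ : ℚ)) = 64 * (a₆ : ℚ) := by ring
  rw [twoDivisionUCubic, b₂_standard, b₄_standard, b₆_standard, h4, h6]

/-- **The shape cubic evaluated**: `c_{M ⊗ ℚ}(e) = e³ + (1 + 4a₂)e² + 16a₄e + 64a₆` in any field of characteristic `0`. [cite: SilvermanAEC2009, III.§1] -/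
theorem aeval_twoDivisionUCubic_standard {K : Type*} [Field K] [CharZero K] [Algebra ℚ K] (e : K) :
    aeval e (twoDivisionUCubic ((⟨1, a₂, 0, a₄, a₆⟩ : WeierstrassCurve ℤ).baseChange ℚ)) =
      e ^ 3 + (1 + 4 * (a₂ : K)) * e ^ 2 + 16 * (a₄ : K) * e + 64 * (a₆ : K) := by
  rw [aeval_twoDivisionUCubic_eq, b₂_standard, b₄_standard, b₆_standard]
  push_cast
  ring

/-- `Δ(M ⊗ ℚ) = Δ(M)` (cast). [folklore] -/
theorem Δ_standard_baseChange :
    ((⟨1, a₂, 0, a₄, a₆⟩ : WeierstrassCurve ℤ).baseChange ℚ).Δ = ((⟨1, a₂, 0, a₄, a₆⟩ : WeierstrassCurve ℤ).Δ : ℚ) :=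
  WeierstrassCurve.baseChange_int_Δ _

/-- **`disc(shape cubic) = 256·Δ[1, a₂, 0, a₄, a₆]`** (`A = 1 + 4a₂`, `B = 16a₄`, `C = 64a₆`, `disc = A²B² − 4B³ − 4A³C − 27C² + 18ABC`): the shape cubic
and the standard model have the same discriminant square class. [cite: SilvermanAEC2009, III.§1 (disc of the 2-division polynomial = 16Δ)] -/
theorem disc_shape_eq :
    (1 + 4 * a₂) ^ 2 * (16 * a₄) ^ 2 - 4 * (16 * a₄) ^ 3 - 4 * (1 + 4 * a₂) ^ 3 * (64 * a₆) - 27 * (64 * a₆) ^ 2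
        + 18 * (1 + 4 * a₂) * (16 * a₄) * (64 * a₆) =
      256 * (⟨1, a₂, 0, a₄, a₆⟩ : WeierstrassCurve ℤ).Δ := by
  simp only [WeierstrassCurve.Δ, WeierstrassCurve.b₂, WeierstrassCurve.b₄, WeierstrassCurve.b₆, WeierstrassCurve.b₈]
  ring

/-- `Δ ∉ ℚ²` for the standard model iff `256·Δ = disc(shape cubic) ∉ ℚ²` (rational version of `disc_shape_eq`). [folklore] -/
theorem isSquare_Δ_standard_iff :
    IsSquare ((⟨1, a₂, 0, a₄, a₆⟩ : WeierstrassCurve ℤ).baseChange ℚ).Δ ↔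
      IsSquare ((1 + 4 * (a₂ : ℚ)) ^ 2 * (16 * a₄) ^ 2 - 4 * (16 * (a₄ : ℚ)) ^ 3 - 4 * (1 + 4 * (a₂ : ℚ)) ^ 3 * (64 * a₆)
        - 27 * (64 * (a₆ : ℚ)) ^ 2 + 18 * (1 + 4 * (a₂ : ℚ)) * (16 * a₄) * (64 * a₆)) := by
  have h : (1 + 4 * (a₂ : ℚ)) ^ 2 * (16 * a₄) ^ 2 - 4 * (16 * (a₄ : ℚ)) ^ 3 - 4 * (1 + 4 * (a₂ : ℚ)) ^ 3 * (64 * a₆)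
        - 27 * (64 * (a₆ : ℚ)) ^ 2 + 18 * (1 + 4 * (a₂ : ℚ)) * (16 * a₄) * (64 * a₆) =
      256 * ((⟨1, a₂, 0, a₄, a₆⟩ : WeierstrassCurve ℤ).baseChange ℚ).Δ := by
    rw [Δ_standard_baseChange]; exact_mod_cast disc_shape_eq a₂ a₄ a₆
  rw [h]
  constructor
  · rintro ⟨s, hs⟩
    exact ⟨16 * s, by linear_combination (256 : ℚ) * hs⟩
  · rintro ⟨s, hs⟩
    exact ⟨s / 16, by linear_combination hs / 256⟩

/-- **A standard model with `a₄ + a₆` odd is an elliptic curve** (`Δ` odd, hence non-zero). [cite: SilvermanAEC2009, III.§1 Prop. 1.4] -/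
theorem isElliptic_standard (h : Odd (a₄ + a₆)) : ((⟨1, a₂, 0, a₄, a₆⟩ : WeierstrassCurve ℤ).baseChange ℚ).IsElliptic := by
  refine ⟨?_⟩
  rw [Δ_standard_baseChange, isUnit_iff_ne_zero, Int.cast_ne_zero]
  intro h0
  have hodd := (odd_Δ_standard_iff a₂ a₄ a₆).mpr h
  rw [h0] at hodd
  exact (by decide : ¬ Odd (0 : ℤ)) hodd

/-- **No rational root of the shape cubic ⟹ no rational `2`-torsion abscissa on the standard model** (a rational `2`-torsion abscissa `x` gives the
root `4x`). [cite: SilvermanAEC2009, III.§1 and III.2.3] -/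
theorem not_hasRationalTwoTorsionX_standard (hirr : ∀ x : ℚ, x ^ 3 + (1 + 4 * (a₂ : ℚ)) * x ^ 2 + 16 * (a₄ : ℚ) * x + 64 * (a₆ : ℚ) ≠ 0) :
    ∀ x : ℚ, ¬ HasRationalTwoTorsionX ((⟨1, a₂, 0, a₄, a₆⟩ : WeierstrassCurve ℤ).baseChange ℚ) x := by
  intro x hx
  rw [hasRationalTwoTorsionX_iff_twoDivision, b₂_standard, b₄_standard, b₆_standard] at hx
  exact hirr (4 * x) (by linear_combination (16 : ℚ) * hx)

/-- **A rational root `u` of the shape cubic gives the rational `2`-torsion abscissa `u/4` on the standard model.** [cite: SilvermanAEC2009, III.2.3] -/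
theorem hasRationalTwoTorsionX_standard_of_root {u : ℚ} (hu : u ^ 3 + (1 + 4 * (a₂ : ℚ)) * u ^ 2 + 16 * (a₄ : ℚ) * u + 64 * (a₆ : ℚ) = 0) :
    HasRationalTwoTorsionX ((⟨1, a₂, 0, a₄, a₆⟩ : WeierstrassCurve ℤ).baseChange ℚ) (u / 4) := by
  rw [hasRationalTwoTorsionX_iff_twoDivision, b₂_standard, b₄_standard, b₆_standard]
  linear_combination hu / 16

/-- **`E(ℚ)[2] = 0` on the standard model ⟺ the shape cubic has no rational root.** [cite: SilvermanAEC2009, III.2.3] -/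
theorem forall_not_hasRationalTwoTorsionX_standard_iff :
    (∀ x : ℚ, ¬ HasRationalTwoTorsionX ((⟨1, a₂, 0, a₄, a₆⟩ : WeierstrassCurve ℤ).baseChange ℚ) x) ↔
      ∀ x : ℚ, x ^ 3 + (1 + 4 * (a₂ : ℚ)) * x ^ 2 + 16 * (a₄ : ℚ) * x + 64 * (a₆ : ℚ) ≠ 0 :=
  ⟨fun h u hu ↦ h (u / 4) (hasRationalTwoTorsionX_standard_of_root a₂ a₄ a₆ hu), not_hasRationalTwoTorsionX_standard a₂ a₄ a₆⟩

/-- **Once globally minimal, a standard model with `a₄ + a₆` odd has GOOD reduction at `2`** (`2 ∤ Δ_min`). [cite: SilvermanAEC2009, VII.§1 Remark 1.1] -/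
theorem hasGoodReductionAtPrime_two_standard (h : Odd (a₄ + a₆))
    [((⟨1, a₂, 0, a₄, a₆⟩ : WeierstrassCurve ℤ).baseChange ℚ).IsGloballyMinimal] :
    ((⟨1, a₂, 0, a₄, a₆⟩ : WeierstrassCurve ℤ).baseChange ℚ).HasGoodReductionAtPrime 2 := by
  refine hasGoodReductionAtPrime_of_not_dvd _ 2 ?_
  rw [Literature.NumberTheory.EllipticCurves.minimalDiscriminantInt_baseChange_int]
  have hodd := (odd_Δ_standard_iff a₂ a₄ a₆).mpr h
  intro h2
  exact Int.not_even_iff_odd.mpr hodd (even_iff_two_dvd.mpr (by exact_mod_cast h2))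

/-- ★ **Once globally minimal, a standard model with `a₄ + a₆` odd is good ORDINARY at `2`** (`a₁ = 1` is odd). [cite: SilvermanAEC2009, V.§4 and Exercise 5.7] -/
theorem isOrdinaryAt_two_standard (h : Odd (a₄ + a₆))
    [((⟨1, a₂, 0, a₄, a₆⟩ : WeierstrassCurve ℤ).baseChange ℚ).IsGloballyMinimal]
    [((⟨1, a₂, 0, a₄, a₆⟩ : WeierstrassCurve ℤ).baseChange ℚ).IsElliptic] :
    IsOrdinaryAt ((⟨1, a₂, 0, a₄, a₆⟩ : WeierstrassCurve ℤ).baseChange ℚ) 2 := by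
  refine (OrdinaryTwistAtTwo.isOrdinaryAt_two_iff_odd_a₁ _ (hasGoodReductionAtPrime_two_standard a₂ a₄ a₆ h)).mpr ?_
  rw [Literature.NumberTheory.EllipticCurves.integralModelInt_baseChange_int]
  exact odd_one

end Standard

/-! ## §2 The normal form over `ℤ` and the shape of a cell curve -/

section NormalForm

/-- ★★ **NORMAL FORM OVER `ℤ` (W-free).** An integer Weierstrass model `M` with `a₁ = 2k + 1` odd is carried by the INTEGRAL change of variables
`C = (u; r, s, t) = (1; a₃, −k, −a₃(k + 1))` to a model with `a₁ = 1` and `a₃ = 0`: `a₁′ = a₁ + 2s = 1`, `a₃′ = a₃ + r·a₁ + 2t = a₃ + a₃(2k+1) −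
2a₃(k+1) = 0`. No unit `u = a₁` is used, so this works over `ℤ`, not only over `ℤ₍₂₎`. [cite: SilvermanAEC2009, III.§1 Table 3.1] -/
theorem exists_variableChange_a₁_one_a₃_zero (M : WeierstrassCurve ℤ) (ha₁ : Odd M.a₁) :
    ∃ C : VariableChange ℤ, C.u = 1 ∧ C.r = M.a₃ ∧ (C • M).a₁ = 1 ∧ (C • M).a₃ = 0 := by
  obtain ⟨k, hk⟩ := ha₁
  refine ⟨⟨1, M.a₃, -k, -(M.a₃ * (k + 1))⟩, rfl, rfl, ?_, ?_⟩
  · rw [variableChange_a₁, hk]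
    simp only [inv_one, Units.val_one, one_mul]
    ring
  · rw [variableChange_a₃, hk]
    simp only [inv_one, Units.val_one, one_pow, one_mul]
    ring

/-- A model with `a₁ = 1`, `a₃ = 0` IS the standard model `[1, a₂, 0, a₄, a₆]` on its own coefficients. [folklore] -/
theorem eq_standard_of_a₁_a₃ (M : WeierstrassCurve ℤ) (h1 : M.a₁ = 1) (h3 : M.a₃ = 0) :
    M = ⟨1, M.a₂, 0, M.a₄, M.a₆⟩ := by
  ext <;> simp [h1, h3]

/-- **The `b`-invariants along an integral change of variables with `u = 1`**: `b₂′ = b₂ + 12r`, `b₄′ = b₄ + rb₂ + 6r²`,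
`b₆′ = b₆ + 2rb₄ + r²b₂ + 4r³`. [cite: SilvermanAEC2009, III.§1 Table 3.1] -/
theorem b_smul_of_u_eq_one (M : WeierstrassCurve ℤ) (C : VariableChange ℤ) (hu : C.u = 1) :
    (C • M).b₂ = M.b₂ + 12 * C.r ∧ (C • M).b₄ = M.b₄ + C.r * M.b₂ + 6 * C.r ^ 2 ∧
      (C • M).b₆ = M.b₆ + 2 * C.r * M.b₄ + C.r ^ 2 * M.b₂ + 4 * C.r ^ 3 := by
  refine ⟨?_, ?_, ?_⟩
  · rw [variableChange_b₂, hu]; simp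
  · rw [variableChange_b₄, hu]; simp
  · rw [variableChange_b₆, hu]; simp

/-- **`Δ` is unchanged by an integral change of variables with `u = 1`.** [cite: SilvermanAEC2009, III.§1 Table 3.1] -/
theorem Δ_smul_of_u_eq_one (M : WeierstrassCurve ℤ) (C : VariableChange ℤ) (hu : C.u = 1) : (C • M).Δ = M.Δ := by
  rw [variableChange_Δ, hu]; simp

/-- **The shape cubic is the `r`-translate of the `u`-cubic**: if `C = (1; r, s, t)` carries `M` to `[1, a₂, 0, a₄, a₆]` then, in every field `K` of
characteristic `0`, `e³ + b₂e² + 8b₄e + 16b₆ = (e − 4r)³ + (1 + 4a₂)(e − 4r)² + 16a₄(e − 4r) + 64a₆` (`bᵢ` the invariants of `M`).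
[cite: SilvermanAEC2009, III.§1 Table 3.1] -/
theorem cubic_eq_shape_translate (M : WeierstrassCurve ℤ) (C : VariableChange ℤ) (hu : C.u = 1) {a₂ a₄ a₆ : ℤ}
    (hM : C • M = ⟨1, a₂, 0, a₄, a₆⟩) {K : Type*} [Field K] [CharZero K] (e : K) :
    e ^ 3 + (M.b₂ : K) * e ^ 2 + 8 * (M.b₄ : K) * e + 16 * (M.b₆ : K) =
      (e - 4 * (C.r : K)) ^ 3 + (1 + 4 * (a₂ : K)) * (e - 4 * (C.r : K)) ^ 2 + 16 * (a₄ : K) * (e - 4 * (C.r : K)) + 64 * (a₆ : K) := by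
  obtain ⟨h₂, h₄, h₆⟩ := b_smul_of_u_eq_one M C hu
  have e₂ : (⟨1, a₂, 0, a₄, a₆⟩ : WeierstrassCurve ℤ).b₂ = 1 + 4 * a₂ := by simp only [WeierstrassCurve.b₂]; ring
  have e₄ : (⟨1, a₂, 0, a₄, a₆⟩ : WeierstrassCurve ℤ).b₄ = 2 * a₄ := by simp only [WeierstrassCurve.b₄]; ring
  have e₆ : (⟨1, a₂, 0, a₄, a₆⟩ : WeierstrassCurve ℤ).b₆ = 4 * a₆ := by simp only [WeierstrassCurve.b₆]; ring
  rw [hM] at h₂ h₄ h₆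
  rw [e₂] at h₂
  rw [e₄] at h₄
  rw [e₆] at h₆
  have k₂ : (1 + 4 * (a₂ : K)) = (M.b₂ : K) + 12 * (C.r : K) := by exact_mod_cast h₂
  have k₄ : (2 * (a₄ : K)) = (M.b₄ : K) + (C.r : K) * (M.b₂ : K) + 6 * (C.r : K) ^ 2 := by exact_mod_cast h₄
  have k₆ : (4 * (a₆ : K)) = (M.b₆ : K) + 2 * (C.r : K) * (M.b₄ : K) + (C.r : K) ^ 2 * (M.b₂ : K) + 4 * (C.r : K) ^ 3 := by
    exact_mod_cast h₆
  linear_combination (-(e - 4 * (C.r : K)) ^ 2) * k₂ - 8 * (e - 4 * (C.r : K)) * k₄ - (16 : K) * k₆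

variable (W : WeierstrassCurve ℚ) [W.IsElliptic] [W.IsGloballyMinimal]

/-- ★★ **THE SHAPE OF A CELL CURVE.** `W/ℚ` globally minimal and good ORDINARY at `2`. Then there are integers `a₂, a₄, a₆, r` with
**`a₄ + a₆` odd**, **`Δ[1, a₂, 0, a₄, a₆] = Δ_min(W)`** (so the sign and the square class of `Δ_W` are those of the standard model), and, in every
field `K` of characteristic `0`, **`c_W(e) = 0 ⟺ (e − 4r)³ + (1 + 4a₂)(e − 4r)² + 16a₄(e − 4r) + 64a₆ = 0`**: the minimal model `[a₁, …, a₆]` has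
`a₁` odd (ordinary) and `Δ` odd (good), the integral change `(1; a₃, −k, −a₃(k+1))` makes it a standard model with the same `Δ`, and the `u`-cubic
moves by the translation `u ↦ u − 4a₃`. [cite: SilvermanAEC2009, III.§1 Table 3.1, V.§4, VII.§1] -/
theorem exists_standardShape_of_isOrdinaryAt (hord : IsOrdinaryAt W 2) :
    ∃ a₂ a₄ a₆ r : ℤ, Odd (a₄ + a₆) ∧ (⟨1, a₂, 0, a₄, a₆⟩ : WeierstrassCurve ℤ).Δ = minimalDiscriminantInt W ∧
      ∀ {K : Type} [Field K] [CharZero K] [Algebra ℚ K] (e : K),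
        aeval e (twoDivisionUCubic W) = 0 ↔
          (e - 4 * (r : K)) ^ 3 + (1 + 4 * (a₂ : K)) * (e - 4 * (r : K)) ^ 2 + 16 * (a₄ : K) * (e - 4 * (r : K)) + 64 * (a₆ : K) = 0 := by
  have ha₁ : Odd (integralModelInt W).a₁ :=
    odd_a₁_of_hasGoodReductionAtPrime_two_of_odd_frobeniusTrace_two W hord.1 (Int.not_even_iff_odd.mp fun h ↦ hord.2 (even_iff_two_dvd.mp h))
  have hΔodd : ¬ (2 : ℤ) ∣ (integralModelInt W).Δ := not_two_dvd_Δ_integralModelInt_of_hasGoodReductionAtPrime_two W hord.1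
  obtain ⟨C, hu, -, h1, h3⟩ := exists_variableChange_a₁_one_a₃_zero (integralModelInt W) ha₁
  have hM' := eq_standard_of_a₁_a₃ (C • integralModelInt W) h1 h3
  obtain ⟨hb₂, hb₄, hb₆⟩ := b₂_b₄_b₆_eq_intCast W
  have hΔ' : (⟨1, (C • integralModelInt W).a₂, 0, (C • integralModelInt W).a₄, (C • integralModelInt W).a₆⟩ : WeierstrassCurve ℤ).Δ =
      (integralModelInt W).Δ := by
    rw [← hM']; exact Δ_smul_of_u_eq_one (integralModelInt W) C hu
  refine ⟨(C • integralModelInt W).a₂, (C • integralModelInt W).a₄, (C • integralModelInt W).a₆, C.r, ?_, ?_, fun e ↦ ?_⟩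
  · refine (odd_Δ_standard_iff (C • integralModelInt W).a₂ _ _).mp ?_
    rw [hΔ']
    exact Int.not_even_iff_odd.mp fun h ↦ hΔodd (even_iff_two_dvd.mp h)
  · rw [hΔ', minimalDiscriminantInt]
  · have key := cubic_eq_shape_translate (integralModelInt W) C hu hM' e
    rw [aeval_twoDivisionUCubic_eq, hb₂, hb₄, hb₆, ← key]
    push_cast
    exact Iff.rfl

omit [W.IsElliptic] [W.IsGloballyMinimal] in
/-- **A rational root of the shape cubic of a cell curve would be a rational `2`-torsion abscissa**: for `W` with `W(ℚ)[2] = 0` and the data of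
`exists_standardShape_of_isOrdinaryAt`, the shape cubic has no rational root. [cite: SilvermanAEC2009, III.2.3] -/
theorem shape_ne_zero_of_forall_not_hasRationalTwoTorsionX (ht : ∀ x : ℚ, ¬ HasRationalTwoTorsionX W x) {a₂ a₄ a₆ r : ℤ}
    (hroot : ∀ {K : Type} [Field K] [CharZero K] [Algebra ℚ K] (e : K),
        aeval e (twoDivisionUCubic W) = 0 ↔
          (e - 4 * (r : K)) ^ 3 + (1 + 4 * (a₂ : K)) * (e - 4 * (r : K)) ^ 2 + 16 * (a₄ : K) * (e - 4 * (r : K)) + 64 * (a₆ : K) = 0) :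
    ∀ x : ℚ, x ^ 3 + (1 + 4 * (a₂ : ℚ)) * x ^ 2 + 16 * (a₄ : ℚ) * x + 64 * (a₆ : ℚ) ≠ 0 := by
  intro x hx
  have hu : aeval (x + 4 * (r : ℚ)) (twoDivisionUCubic W) = 0 := (hroot (K := ℚ) (x + 4 * (r : ℚ))).mpr (by simpa using hx)
  rw [aeval_twoDivisionUCubic_eq] at hu
  simp only [Rat.cast_id] at hu
  refine ht ((x + 4 * (r : ℚ)) / 4) ((hasRationalTwoTorsionX_iff_twoDivision W _).mpr ?_)
  linear_combination hu / 16

end NormalForm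

end Summit.BirchSwinnertonDyer.BirchSwinnertonDyer.Theorems.AlignedTransportAtTwoOrdinaryStandardShape

end
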